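import Summits.HodgeConjecture.HodgeCM.PerL34.SupplyElementary_1

/-! PORT of `HodgeCM/PerL34/SupplyElementary.lean` (HodgeCMPerL run 81) — part 2: continuation of `Summits.HodgeConjecture.HodgeCM.PerL34.SupplyElementary_1` (split at a top-level declaration boundary by port_pkg.py; scope re-opened below; declarations unchanged). -/

-- port_pkg: scope re-opened for this part (file-level context, then the namespace/section stack open at the cut)
set_option autoImplicit false
noncomputable section
open MeasureTheory Filter Topology
open scoped BigOperators ComplexConjugate
namespace HodgeCM
namespace PerL34
namespace SupplyElementary
section Fourier
variable {G : Type*} [CommGroup G] [TopologicalSpace G]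
variable [CompactSpace G] [MeasurableSpace G] [BorelSpace G] (μ : Measure G) [IsFiniteMeasure μ]
variable [μ.IsOpenPosMeasure]
omit [CompactSpace G] [IsFiniteMeasure μ] [μ.IsOpenPosMeasure] in
/-- **(E3)** If `f` is `w`-equivariant under right translation by a subgroup `i : B →* G`
(`f (g · i t) = w t · f g`) and the Fourier coefficient of `f` against `χ` is nonzero, then `χ ∘ i = w⁻¹`:
the character has the archimedean type forced by the weight (prl2 (E): "U(W_i)(ℝ) acting on φ_∞ by
∏_b u_b^{−e_b(Ψ_i)} forces χ′_∞ = type e(Ψ_i)").  Right-invariance of `μ` only. -/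
theorem char_mul_weight_eq_one [IsTopologicalGroup G] [μ.IsMulRightInvariant] {B : Type*} [Monoid B] (i : B →* G) (w : B → ℂ)
    (f : G → ℂ) (hf : ∀ (g : G) (t : B), f (g * i t) = w t * f g) (χ : PontryaginDual G)
    (hne : ∫ g, f g * ((χ g : Circle) : ℂ) ∂μ ≠ 0) (t : B) : ((χ (i t) : Circle) : ℂ) * w t = 1 := by
  have hinv := integral_mul_right_eq_self (μ := μ) (fun g => f g * ((χ g : Circle) : ℂ)) (i t)
  have h2 : (fun g => f (g * i t) * ((χ (g * i t) : Circle) : ℂ))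
      = fun g => (((χ (i t) : Circle) : ℂ) * w t) * (f g * ((χ g : Circle) : ℂ)) := by
    funext g
    rw [hf, map_mul, Circle.coe_mul]
    ring
  rw [h2, integral_const_mul] at hinv
  have h3 : (((χ (i t) : Circle) : ℂ) * w t) * (∫ g, f g * ((χ g : Circle) : ℂ) ∂μ)
      = 1 * ∫ g, f g * ((χ g : Circle) : ℂ) ∂μ := by rw [hinv, one_mul]
  exact mul_right_cancel₀ hne h3

/-- **(E2)+(E3): the elementary supply lemma.**  A nonzero continuous `w`-equivariant function on a compact
abelian group with completeness of characters has a nonzero Fourier coefficient against a character of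
type `w⁻¹` on `i(B)`. -/
theorem supply_elementary [IsTopologicalGroup G] [μ.IsMulRightInvariant] (hsep : CharSeparating G) {B : Type*} [Monoid B]
    (i : B →* G) (w : B → ℂ) (θ : C(G, ℂ)) (hθ : θ ≠ 0) (heq : ∀ (g : G) (t : B), θ (g * i t) = w t * θ g) :
    ∃ χ : PontryaginDual G,
      (∫ g, θ g * ((χ g : Circle) : ℂ) ∂μ ≠ 0) ∧ ∀ t : B, ((χ (i t) : Circle) : ℂ) * w t = 1 := by
  obtain ⟨χ, hχ⟩ := exists_integral_mul_char_ne_zero μ hsep θ hθ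
  exact ⟨χ, hχ, char_mul_weight_eq_one μ i w θ heq χ hχ⟩

end Fourier

/-! ### (E4) Assembly over the lattice/theta shell of `Seesaw.lean` -/

section Shell

open HodgeCM.PerL34.Seesaw

variable (DS : ThetaSeesawData)

/-- **SUPPLY for `W₁` over the shell (E2+E3).**  `[U(W₁)] = DS.A₁` a compact abelian group with completeness of
characters (PRINT `CharSeparating`), `ν₁` a finite right-invariant measure of full support (Haar); if the theta
kernel `u ↦ θ_φ(g,u)` is continuous, not identically zero, and `w`-equivariant under `i : U(W₁)(L₀⊗ℝ) → [U(W₁)]`,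
then some continuous unitary (hence automorphic) character `χ′` of `[U(W₁)]` of type `w⁻¹` on `i` has
`θ(φ,χ′)(g) = ∫ θ_φ(g,u) χ′(u) dν₁ ≠ 0`. -/
theorem supply_thetaLift₁ [CommGroup DS.A₁] [TopologicalSpace DS.A₁] [IsTopologicalGroup DS.A₁]
    [CompactSpace DS.A₁] [MeasurableSpace DS.A₁] [BorelSpace DS.A₁] (ν₁ : Measure DS.A₁) [IsFiniteMeasure ν₁]
    [ν₁.IsOpenPosMeasure] [ν₁.IsMulRightInvariant] (hsep : CharSeparating DS.A₁) {B : Type*} [Monoid B]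
    (i : B →* DS.A₁) (w : B → ℂ) (φ : DS.S₁) (g : DS.G) (hcont : Continuous fun u => DS.thetaKernel₁ φ g u)
    (hne : ∃ u, DS.thetaKernel₁ φ g u ≠ 0)
    (heq : ∀ (u : DS.A₁) (t : B), DS.thetaKernel₁ φ g (u * i t) = w t * DS.thetaKernel₁ φ g u) :
    ∃ χ : PontryaginDual DS.A₁,
      DS.thetaLift₁ ν₁ (fun u => ((χ u : Circle) : ℂ)) φ g ≠ 0 ∧ ∀ t : B, ((χ (i t) : Circle) : ℂ) * w t = 1 := by
  set θ : C(DS.A₁, ℂ) := ⟨fun u => DS.thetaKernel₁ φ g u, hcont⟩ with hθ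
  have hθ0 : θ ≠ 0 := by
    obtain ⟨u, hu⟩ := hne
    intro h
    exact hu (by simpa [hθ] using congrArg (fun f : C(DS.A₁, ℂ) => f u) h)
  obtain ⟨χ, h1, h2⟩ := supply_elementary ν₁ hsep i w θ hθ0 (fun u t => heq u t)
  exact ⟨χ, h1, h2⟩

/-- The same for `W₂`. -/
theorem supply_thetaLift₂ [CommGroup DS.A₂] [TopologicalSpace DS.A₂] [IsTopologicalGroup DS.A₂]
    [CompactSpace DS.A₂] [MeasurableSpace DS.A₂] [BorelSpace DS.A₂] (ν₂ : Measure DS.A₂) [IsFiniteMeasure ν₂]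
    [ν₂.IsOpenPosMeasure] [ν₂.IsMulRightInvariant] (hsep : CharSeparating DS.A₂) {B : Type*} [Monoid B]
    (i : B →* DS.A₂) (w : B → ℂ) (φ : DS.S₂) (g : DS.G) (hcont : Continuous fun u => DS.thetaKernel₂ φ g u)
    (hne : ∃ u, DS.thetaKernel₂ φ g u ≠ 0)
    (heq : ∀ (u : DS.A₂) (t : B), DS.thetaKernel₂ φ g (u * i t) = w t * DS.thetaKernel₂ φ g u) :
    ∃ χ : PontryaginDual DS.A₂,
      DS.thetaLift₂ ν₂ (fun u => ((χ u : Circle) : ℂ)) φ g ≠ 0 ∧ ∀ t : B, ((χ (i t) : Circle) : ℂ) * w t = 1 := by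
  set θ : C(DS.A₂, ℂ) := ⟨fun u => DS.thetaKernel₂ φ g u, hcont⟩ with hθ
  have hθ0 : θ ≠ 0 := by
    obtain ⟨u, hu⟩ := hne
    intro h
    exact hu (by simpa [hθ] using congrArg (fun f : C(DS.A₂, ℂ) => f u) h)
  obtain ⟨χ, h1, h2⟩ := supply_elementary ν₂ hsep i w θ hθ0 (fun u t => heq u t)
  exact ⟨χ, h1, h2⟩

/-- **SUPPLY(t¹) over the lattice model (E1+E2+E3).**  A family `φ_N = φ_∞ ⊗ 1_{x₀ + N𝔏}` of Schwartz–Bruhat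
functions (`φN : ℕ → DS.S₁`) whose theta value at a base point is the thinned lattice sum
`θ_{φ_N}(g₀,u₀) = Σ_{v ∈ Λ} F (N • v)` (`F v = φ_∞(x₀ + v)`; the DICTIONARY hypothesis `hval`, D4) with
`F 0 = φ_∞(x₀) ≠ 0` yields, for some `N`, a nonzero theta lift of `φ_N` against an automorphic character of the
type forced by the weight `w` of `φ_∞`. -/
theorem supply₁_of_lattice [CommGroup DS.A₁] [TopologicalSpace DS.A₁] [IsTopologicalGroup DS.A₁]
    [CompactSpace DS.A₁] [MeasurableSpace DS.A₁] [BorelSpace DS.A₁] (ν₁ : Measure DS.A₁) [IsFiniteMeasure ν₁]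
    [ν₁.IsOpenPosMeasure] [ν₁.IsMulRightInvariant] (hsep : CharSeparating DS.A₁) {B : Type*} [Monoid B]
    (i : B →* DS.A₁) (w : B → ℂ) {Λ : Type*} [AddCommGroup Λ] (ℓ : Λ → ℕ) (hℓ0 : ∀ v, ℓ v = 0 ↔ v = 0)
    (hℓ : ∀ (N : ℕ) (v : Λ), ℓ (N • v) = N * ℓ v) (F : Λ → ℂ) (hF : Summable fun v => ‖F v‖)
    (hF0 : F 0 ≠ 0) (φN : ℕ → DS.S₁) (g₀ : DS.G) (u₀ : DS.A₁)
    (hval : ∀ N : ℕ, DS.thetaKernel₁ (φN N) g₀ u₀ = ∑' v, F (N • v))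
    (hcont : ∀ N : ℕ, Continuous fun u => DS.thetaKernel₁ (φN N) g₀ u)
    (heq : ∀ (N : ℕ) (u : DS.A₁) (t : B),
      DS.thetaKernel₁ (φN N) g₀ (u * i t) = w t * DS.thetaKernel₁ (φN N) g₀ u) :
    ∃ (N : ℕ) (χ : PontryaginDual DS.A₁),
      DS.thetaLift₁ ν₁ (fun u => ((χ u : Circle) : ℂ)) (φN N) g₀ ≠ 0 ∧
        ∀ t : B, ((χ (i t) : Circle) : ℂ) * w t = 1 := by
  obtain ⟨N, hN⟩ := (eventually_tsum_nsmul_ne_zero ℓ hℓ0 hℓ F hF hF0).exists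
  have hne : ∃ u, DS.thetaKernel₁ (φN N) g₀ u ≠ 0 := ⟨u₀, by rw [hval N]; exact hN⟩
  obtain ⟨χ, h1, h2⟩ := supply_thetaLift₁ DS ν₁ hsep i w (φN N) g₀ (hcont N) hne (heq N)
  exact ⟨N, χ, h1, h2⟩

/-- **SUPPLY(t²)**: the same over `W₂`. -/
theorem supply₂_of_lattice [CommGroup DS.A₂] [TopologicalSpace DS.A₂] [IsTopologicalGroup DS.A₂]
    [CompactSpace DS.A₂] [MeasurableSpace DS.A₂] [BorelSpace DS.A₂] (ν₂ : Measure DS.A₂) [IsFiniteMeasure ν₂]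
    [ν₂.IsOpenPosMeasure] [ν₂.IsMulRightInvariant] (hsep : CharSeparating DS.A₂) {B : Type*} [Monoid B]
    (i : B →* DS.A₂) (w : B → ℂ) {Λ : Type*} [AddCommGroup Λ] (ℓ : Λ → ℕ) (hℓ0 : ∀ v, ℓ v = 0 ↔ v = 0)
    (hℓ : ∀ (N : ℕ) (v : Λ), ℓ (N • v) = N * ℓ v) (F : Λ → ℂ) (hF : Summable fun v => ‖F v‖)
    (hF0 : F 0 ≠ 0) (φN : ℕ → DS.S₂) (g₀ : DS.G) (u₀ : DS.A₂)
    (hval : ∀ N : ℕ, DS.thetaKernel₂ (φN N) g₀ u₀ = ∑' v, F (N • v))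
    (hcont : ∀ N : ℕ, Continuous fun u => DS.thetaKernel₂ (φN N) g₀ u)
    (heq : ∀ (N : ℕ) (u : DS.A₂) (t : B),
      DS.thetaKernel₂ (φN N) g₀ (u * i t) = w t * DS.thetaKernel₂ (φN N) g₀ u) :
    ∃ (N : ℕ) (χ : PontryaginDual DS.A₂),
      DS.thetaLift₂ ν₂ (fun u => ((χ u : Circle) : ℂ)) (φN N) g₀ ≠ 0 ∧
        ∀ t : B, ((χ (i t) : Circle) : ℂ) * w t = 1 := by
  obtain ⟨N, hN⟩ := (eventually_tsum_nsmul_ne_zero ℓ hℓ0 hℓ F hF hF0).exists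
  have hne : ∃ u, DS.thetaKernel₂ (φN N) g₀ u ≠ 0 := ⟨u₀, by rw [hval N]; exact hN⟩
  obtain ⟨χ, h1, h2⟩ := supply_thetaLift₂ DS ν₂ hsep i w (φN N) g₀ (hcont N) hne (heq N)
  exact ⟨N, χ, h1, h2⟩

end Shell

end SupplyElementary
end PerL34
end HodgeCM

end
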